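import Summits.CriticalPhenomena.PercolationContinuityZ3.Theorems.PercNearOneGluingNoHeavyLowerTailSunflowerStarCompositionPrelim
import HarnessLib

/-!
# `NoHeavyLowerTail` (crux stmt-CriticalPhenomena-4575), abstract sunflower cubic: the partition lemma ★ HOLDS for every STAR-TYPE
# COMPOSITION (three monotone structures on disjoint coordinate groups; petal `i` = "the other two groups fire", kernel = "all three fire"),
# where Lemma A is an IDENTITY `NV = NAA` realised by a block-switching bijection — II: the bijection `Ψ` and the theorems

Support file (seat `prim-ineq-prove-1` gen 29; `--supports stmt-CriticalPhenomena-4575`).  Nothing is asserted about the crux; no `sorry`.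
Memo: run/shared/lean/prim/prim-ineq-prove-1/FINDING-PAYER-prove1-g29.md §2, §5.3.

SETTING.  The ground type `α` is split into three groups by `grp : α → Fin 3`; `U i` is an up-set of `2^α` SUPPORTED on group `i`
(`S ∈ U i ↔ S ∩ group i ∈ U i`).  The star-type composition is the sunflower `V i := ⋂_{j ≠ i} U j` (all pairwise intersections `= U 0 ∩ U 1 ∩ U 2`):
the `K_{1,3}` stars `{j ~ k}_i` of bond percolation with ARBITRARY edge multiplicities and arbitrary monotone gadgets per edge group, in particular the
doubled star of `…SunflowerDoubledStar` / `…SunflowerPartitionLemmaBRefutation` (the refutation of Lemma B and the first sunflower without a good coordinate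
for the `(MZ)` mechanisms of prim-l12-p2 g8).

THEOREM (`StarData.NV_eq_NAA`, this work): for every star-type composition, `NV = NAA` — the ordered 3-partitions `(P¹,P²,P³)` with `Pⁱ ∈ V i`
are equinumerous with those with `P¹, P² ∈ A`, via the block switching `Ψ`: on group `0` send the pieces of `(P¹,P²,P³)` to `(P³,P¹,P²)`'s slots
as `(P²,P³,P¹)`, on group `1` swap the pieces of `P²` and `P³`, on group `2` do nothing (memo §5.3).  Hence (`…CoreCounts`: `3·SA − Ntri = 6(NAA − NV)`)
Lemma A is an identity, and with `SB ≥ 0` (antipodal Gladkov) **`0 ≤ ZH`**: the partition lemma holds on this infinite family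
(`StarData.ZH_nonneg`), hence so do its law-level consequences there (`H_{q+t}`-, `γ`-type rows via prim-l12-p2's transfer theorems).
-/

namespace Summit.CriticalPhenomena.PercolationContinuityZ3.Theorems.SunflowerPartition

open Finset

variable {α : Type*} [Fintype α] [DecidableEq α]

namespace StarData

variable (D : StarData α)

/-! ### The switching bijection `Ψ` and the identity `NV = NAA` -/

/-- The forward switching on ordered 3-partitions `(P¹,P²)` (third block `= (P¹ ∪ P²)ᶜ`):
`P¹' = mix P² P¹ P¹`, `P²' = mix P³ P³ P²`. [this work] -/
def psi (q : Finset α × Finset α) : Finset α × Finset α :=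
  (D.mix q.2 q.1 q.1, D.mix (q.1 ∪ q.2)ᶜ (q.1 ∪ q.2)ᶜ q.2)

/-- The inverse switching: `P¹ = mix Q³ Q¹ Q¹`, `P² = mix Q¹ Q³ Q²`. [this work] -/
def psiInv (q : Finset α × Finset α) : Finset α × Finset α :=
  (D.mix (q.1 ∪ q.2)ᶜ q.1 q.1, D.mix q.1 (q.1 ∪ q.2)ᶜ q.2)

/-- The third block of `Ψ(P¹,P²,P³)` is `mix P¹ P² P³`. [this work] -/
theorem psi_third (q : Finset α × Finset α) (hq : Disjoint q.1 q.2) :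
    ((D.psi q).1 ∪ (D.psi q).2)ᶜ = D.mix q.1 q.2 (q.1 ∪ q.2)ᶜ := by
  unfold psi
  dsimp only
  rw [D.mix_union, D.mix_compl]
  have hx : ∀ x, x ∈ q.1 → x ∉ q.2 := fun x h => Finset.disjoint_left.1 hq h
  refine D.mix_congr ?_ ?_ ?_ <;> intro x _ <;> have hx' := hx x <;> simp only [mem_compl, mem_union] <;> tauto

/-- The third block of `Ψ⁻¹(Q¹,Q²,Q³)` is `mix Q² Q² Q³`. [this work] -/
theorem psiInv_third (q : Finset α × Finset α) (hq : Disjoint q.1 q.2) :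
    ((D.psiInv q).1 ∪ (D.psiInv q).2)ᶜ = D.mix q.2 q.2 (q.1 ∪ q.2)ᶜ := by
  unfold psiInv
  dsimp only
  rw [D.mix_union, D.mix_compl]
  have hx : ∀ x, x ∈ q.1 → x ∉ q.2 := fun x h => Finset.disjoint_left.1 hq h
  refine D.mix_congr ?_ ?_ ?_ <;> intro x _ <;> have hx' := hx x <;> simp only [mem_compl, mem_union] <;> tauto

/-- `Ψ` maps ordered 3-partitions to ordered 3-partitions. [this work] -/
theorem psi_mem_parts (q : Finset α × Finset α) (hq : q ∈ parts α) : D.psi q ∈ parts α := by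
  unfold parts at hq ⊢
  rw [mem_filter] at hq ⊢
  refine ⟨mem_univ _, ?_⟩
  unfold psi
  exact D.disjoint_mix (disjoint_compl_right.mono_left subset_union_right) (disjoint_compl_right.mono_left subset_union_left) hq.2

/-- `Ψ⁻¹` maps ordered 3-partitions to ordered 3-partitions. [this work] -/
theorem psiInv_mem_parts (q : Finset α × Finset α) (hq : q ∈ parts α) : D.psiInv q ∈ parts α := by
  unfold parts at hq ⊢
  rw [mem_filter] at hq ⊢
  refine ⟨mem_univ _, ?_⟩
  unfold psiInv
  exact D.disjoint_mix (disjoint_compl_left.mono_right subset_union_left) (disjoint_compl_right.mono_left subset_union_left) hq.2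

/-- `Ψ⁻¹ ∘ Ψ = id` on ordered 3-partitions. [this work] -/
theorem psiInv_psi (q : Finset α × Finset α) (hq : Disjoint q.1 q.2) : D.psiInv (D.psi q) = q := by
  have h3 := D.psi_third q hq
  unfold psiInv
  rw [h3]
  unfold psi
  dsimp only
  refine Prod.ext ?_ ?_
  · conv_rhs => rw [← D.mix_self q.1]
    refine D.mix_congr ?_ ?_ ?_ <;> intro y hy <;> simp [D.mem_mix, hy]
  · conv_rhs => rw [← D.mix_self q.2]
    refine D.mix_congr ?_ ?_ ?_ <;> intro y hy <;> simp [D.mem_mix, hy]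

/-- `Ψ ∘ Ψ⁻¹ = id` on ordered 3-partitions. [this work] -/
theorem psi_psiInv (q : Finset α × Finset α) (hq : Disjoint q.1 q.2) : D.psi (D.psiInv q) = q := by
  have h3 := D.psiInv_third q hq
  unfold psi
  rw [h3]
  unfold psiInv
  dsimp only
  refine Prod.ext ?_ ?_
  · conv_rhs => rw [← D.mix_self q.1]
    refine D.mix_congr ?_ ?_ ?_ <;> intro y hy <;> simp [D.mem_mix, hy]
  · conv_rhs => rw [← D.mix_self q.2]
    refine D.mix_congr ?_ ?_ ?_ <;> intro y hy <;> simp [D.mem_mix, hy]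

/-- **Lemma A is an identity on star-type compositions**: `NV = NAA`. [this work] -/
theorem NV_eq_NAA : D.toSunflower.NV = D.toSunflower.NAA := by
  rw [D.toSunflower.NV_eq_card, D.toSunflower.NAA_eq_card, Nat.cast_inj]
  refine card_nbij' D.psi D.psiInv ?_ ?_ ?_ ?_
  · -- Ψ maps {Pⁱ ∈ V i} into {P¹', P²' ∈ A}
    intro q hq
    simp only [coe_filter, Set.mem_setOf_eq] at hq ⊢
    obtain ⟨hp, h0, h1, h2⟩ := hq
    rw [D.toSunflower.lab_V0_iff, D.mem_V_iff] at h0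
    rw [D.toSunflower.lab_V1_iff, D.mem_V_iff] at h1
    rw [D.toSunflower.lab_V2_iff, D.mem_V_iff] at h2
    refine ⟨D.psi_mem_parts q hp, ?_, ?_⟩
    · rw [D.toSunflower.lab_eq_four_iff, D.mem_A_iff]
      intro j
      unfold psi
      dsimp only
      have : j = 0 ∨ j = 1 ∨ j = 2 := by fin_cases j <;> simp
      rcases this with rfl | rfl | rfl
      · rw [D.mix_mem_U0]; exact h1 0 (by decide)
      · rw [D.mix_mem_U1]; exact h0 1 (by decide)
      · rw [D.mix_mem_U2]; exact h0 2 (by decide)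
    · rw [D.toSunflower.lab_eq_four_iff, D.mem_A_iff]
      intro j
      unfold psi
      dsimp only
      have : j = 0 ∨ j = 1 ∨ j = 2 := by fin_cases j <;> simp
      rcases this with rfl | rfl | rfl
      · rw [D.mix_mem_U0]; exact h2 0 (by decide)
      · rw [D.mix_mem_U1]; exact h2 1 (by decide)
      · rw [D.mix_mem_U2]; exact h1 2 (by decide)
  · -- Ψ⁻¹ maps {P¹', P²' ∈ A} into {Pⁱ ∈ V i}
    intro q hq
    simp only [coe_filter, Set.mem_setOf_eq] at hq ⊢
    obtain ⟨hp, hA1, hA2⟩ := hq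
    rw [D.toSunflower.lab_eq_four_iff, D.mem_A_iff] at hA1 hA2
    have hd : Disjoint q.1 q.2 := by unfold parts at hp; exact (mem_filter.1 hp).2
    refine ⟨D.psiInv_mem_parts q hp, ?_, ?_, ?_⟩
    · rw [D.toSunflower.lab_V0_iff, D.mem_V_iff]; intro j hj
      unfold psiInv
      dsimp only
      have : j = 1 ∨ j = 2 := by fin_cases j <;> simp at hj ⊢
      rcases this with rfl | rfl
      · rw [D.mix_mem_U1]; exact hA1 1
      · rw [D.mix_mem_U2]; exact hA1 2
    · rw [D.toSunflower.lab_V1_iff, D.mem_V_iff]; intro j hj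
      unfold psiInv
      dsimp only
      have : j = 0 ∨ j = 2 := by fin_cases j <;> simp at hj ⊢
      rcases this with rfl | rfl
      · rw [D.mix_mem_U0]; exact hA1 0
      · rw [D.mix_mem_U2]; exact hA2 2
    · rw [D.toSunflower.lab_V2_iff, D.psiInv_third q hd, D.mem_V_iff]; intro j hj
      have : j = 0 ∨ j = 1 := by fin_cases j <;> simp at hj ⊢
      rcases this with rfl | rfl
      · rw [D.mix_mem_U0]; exact hA2 0
      · rw [D.mix_mem_U1]; exact hA2 1
  · intro q hq
    simp only [coe_filter, Set.mem_setOf_eq] at hq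
    have hd : Disjoint q.1 q.2 := by have hp := hq.1; unfold parts at hp; exact (mem_filter.1 hp).2
    exact D.psiInv_psi q hd
  · intro q hq
    simp only [coe_filter, Set.mem_setOf_eq] at hq
    have hd : Disjoint q.1 q.2 := by have hp := hq.1; unfold parts at hp; exact (mem_filter.1 hp).2
    exact D.psi_psiInv q hd

/-- **The partition lemma holds for every star-type composition**: `0 ≤ ZH`. [this work] -/
theorem ZH_nonneg : 0 ≤ D.toSunflower.ZH :=
  D.toSunflower.ZH_nonneg_of_NV_le_NAA (le_of_eq D.NV_eq_NAA)

/-- On star-type compositions the kernel spectators pay EXACTLY: `3·SA = Ntri`. [this work] -/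
theorem three_SA_eq_Ntri : 3 * D.toSunflower.SA = D.toSunflower.Ntri := by
  have h := D.toSunflower.three_SA_sub_Ntri
  rw [D.NV_eq_NAA, sub_self, mul_zero] at h
  linarith

end StarData

end Summit.CriticalPhenomena.PercolationContinuityZ3.Theorems.SunflowerPartition
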